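import Literature.Probability.RandomPlanarGeometry.SAWAdsorptionUpperBound
import Literature.Probability.RandomPlanarGeometry.SAWBridgeGrowth
import HarnessLib

/-!
# The desorbed phase of the half-plane self-avoiding walk: `κ(a) = log μ` for `0 ≤ a ≤ 1`

Topic `Literature/Probability/RandomPlanarGeometry` (continues `SAWAdsorptionUpperBound.lean` — `hpWalks`, `wallVisits`,
`adsZ n a = Z⁺_n(a)`, `AdsorbedAbove a Λ` — and `SAWBridgeGrowth.lean`, `Zd.tendsto_bridgeCount_rpow : b_n^{1/n} → μ`).

Beaton–Guttmann–Jensen 2012, §1 (p. 2), reporting Hammersley–Torrie–Whittington 1982 and Whittington 1975: the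
adsorption free energy `κ(α) = lim n⁻¹ log Z_n(α)` (`a = e^α`) satisfies `κ(α) = log μ` for `α < 0` and
`κ(α) ≥ max[log μ, α]` for `α ≥ 0`, whence a critical value `0 ≤ α_c ≤ log μ` (`1 ≤ a_c ≤ μ`). This file proves the
finite-volume facts behind the desorbed half and the window, for the square lattice and vertex weights:

* `Zd.bridgeCount_le_adsZ` — `b_n ≤ Z⁺_n(a)` for every `a ≥ 0` (a bridge is a half-plane walk that never returns to
  the wall, weight `a⁰ = 1`);
* `Zd.adsZ_le_count` — `Z⁺_n(a) ≤ c_n` for `0 ≤ a ≤ 1`; `Zd.adsZ_mono` — `Z⁺_n` is non-decreasing in `a ≥ 0`;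
* **`Zd.tendsto_adsZ_rpow_of_le_one`** — for `0 ≤ a ≤ 1`, `Z⁺_n(a)^{1/n} → μ(ℤ²)`: the free energy exists and equals
  `log μ` throughout the desorbed range (squeeze between `b_n^{1/n} → μ` and `c_n^{1/n} → μ`);
* `Zd.AdsorbedAbove.mono` / `Zd.AdsorbedAbove.of_le` — `AdsorbedAbove a Λ` is upward closed in `a` and downward
  closed in `Λ`; **`Zd.not_adsorbedAbove_of_le_one`** — for `0 ≤ a ≤ 1` and `Λ > μ`, `¬ AdsorbedAbove a Λ`.

Together with the tree's certificates `Zd.adsorbedAbove_212` (and `Zd.adsorbedAbove_209`): in the sense of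
`AdsorbedAbove · Λ` with `μ < Λ ≤ 2.69`, the adsorption transition of the square lattice lies in `(1, 2.12]`
(`(1, 2.09]`), every statement kernel-checked.
-/

open Finset Filter Topology Literature.Probability.LatticeModels SimpleGraph
open scoped BigOperators

namespace Literature.Probability.RandomPlanarGeometry.SAW.Zd

/-! ### Bridges are half-plane walks of weight one -/

/-- A bridge (`0 = ω₀(0) < ω₀(i) ≤ ω₀(n)`) is a half-plane walk. [cite: BeatonGuttmannJensen2012Adsorption, §1 (p. 2)]
[cite: MadrasSlade1993, Definition 1.2.4 (p. 10)] -/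
theorem bridges_subset_hpWalks (n : ℕ) : bridges 2 n ⊆ hpWalks n := by
  classical
  intro ω hω
  rw [mem_bridges] at hω
  unfold hpWalks
  rw [Finset.mem_filter]
  refine ⟨hω.1, fun i hi => ?_⟩
  have h0 : ω 0 = 0 := (mem_saws.1 hω.1).1
  rcases Nat.eq_zero_or_pos i with rfl | hpos
  · rw [h0]; exact le_rfl
  · have := (hω.2 i hpos hi).1
    rw [h0] at this
    exact le_of_lt this

/-- A bridge never returns to the wall: its wall-visit count is `0`. [cite: BeatonGuttmannJensen2012Adsorption, §1 (p. 2)]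
[cite: MadrasSlade1993, Definition 1.2.4 (p. 10)] -/
theorem wallVisits_eq_zero_of_mem_bridges {n : ℕ} {ω : ℕ → Site 2} (hω : ω ∈ bridges 2 n) : wallVisits n ω = 0 := by
  classical
  rw [mem_bridges] at hω
  have h0 : ω 0 = 0 := (mem_saws.1 hω.1).1
  unfold wallVisits
  rw [Finset.card_eq_zero, Finset.filter_eq_empty_iff]
  rintro k hk ⟨hk1, hk0⟩
  rw [Finset.mem_range] at hk
  have := (hω.2 k hk1 (by omega)).1
  rw [h0, hk0] at this
  exact lt_irrefl _ this

/-- **`b_n ≤ Z⁺_n(a)`** for every `a ≥ 0`. [cite: BeatonGuttmannJensen2012Adsorption, §1 (p. 2)]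
[cite: MadrasSlade1993, Definition 1.2.4 (p. 10)] -/
theorem bridgeCount_le_adsZ (n : ℕ) {a : ℝ} (ha : 0 ≤ a) : (bridgeCount 2 n : ℝ) ≤ adsZ n a := by
  classical
  unfold adsZ bridgeCount
  calc (#(bridges 2 n) : ℝ) = ∑ ω ∈ bridges 2 n, a ^ wallVisits n ω := by
        rw [Finset.sum_congr rfl fun ω hω => by rw [wallVisits_eq_zero_of_mem_bridges hω, pow_zero]]
        simp
    _ ≤ ∑ ω ∈ hpWalks n, a ^ wallVisits n ω :=
        Finset.sum_le_sum_of_subset_of_nonneg (bridges_subset_hpWalks n) fun _ _ _ => pow_nonneg ha _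

/-! ### Upper bound and monotonicity -/

/-- `Z⁺_n(a) ≥ 0` for `a ≥ 0`. [cite: BeatonGuttmannJensen2012Adsorption, §1 (p. 2)] -/
theorem adsZ_nonneg (n : ℕ) {a : ℝ} (ha : 0 ≤ a) : 0 ≤ adsZ n a :=
  Finset.sum_nonneg fun _ _ => pow_nonneg ha _

/-- **`Z⁺_n(a) ≤ c_n`** for `0 ≤ a ≤ 1`. [cite: BeatonGuttmannJensen2012Adsorption, §1 (p. 2)] -/
theorem adsZ_le_count (n : ℕ) {a : ℝ} (ha0 : 0 ≤ a) (ha1 : a ≤ 1) : adsZ n a ≤ count 2 n := by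
  classical
  unfold adsZ
  calc ∑ ω ∈ hpWalks n, a ^ wallVisits n ω ≤ ∑ _ω ∈ hpWalks n, (1 : ℝ) :=
        Finset.sum_le_sum fun ω _ => pow_le_one₀ ha0 ha1
    _ = #(hpWalks n) := by simp
    _ ≤ #(saws 2 n) := by
        unfold hpWalks
        exact_mod_cast Finset.card_le_card (Finset.filter_subset _ _)
    _ = count 2 n := by rw [card_saws]

/-- `Z⁺_n(a)` is non-decreasing in `a ≥ 0`. [cite: BeatonGuttmannJensen2012Adsorption, §1 (p. 2)] -/
theorem adsZ_mono (n : ℕ) {a b : ℝ} (ha : 0 ≤ a) (hab : a ≤ b) : adsZ n a ≤ adsZ n b :=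
  Finset.sum_le_sum fun _ _ => pow_le_pow_left₀ ha hab _

/-- `AdsorbedAbove a Λ` is upward closed in the fugacity `a ≥ 0`. [cite: BeatonGuttmannJensen2012Adsorption, §1 (p. 2)] -/
theorem AdsorbedAbove.mono {a b Λ : ℝ} (h : AdsorbedAbove a Λ) (ha : 0 ≤ a) (hab : a ≤ b) : AdsorbedAbove b Λ := by
  obtain ⟨K, hK, hKn⟩ := h
  exact ⟨K, hK, fun n => (hKn n).trans (adsZ_mono n ha hab)⟩

/-- `AdsorbedAbove a Λ` is downward closed in the rate `Λ ≥ 0`. [cite: BeatonGuttmannJensen2012Adsorption, §1 (p. 2)] -/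
theorem AdsorbedAbove.of_le {a Λ Λ' : ℝ} (h : AdsorbedAbove a Λ) (hΛ' : 0 ≤ Λ') (hle : Λ' ≤ Λ) : AdsorbedAbove a Λ' := by
  obtain ⟨K, hK, hKn⟩ := h
  exact ⟨K, hK, fun n => le_trans (mul_le_mul_of_nonneg_left (pow_le_pow_left₀ hΛ' hle n) hK.le) (hKn n)⟩

/-! ### The desorbed phase -/

/-- **The desorbed phase (Whittington 1975; Hammersley–Torrie–Whittington 1982): for `0 ≤ a ≤ 1` the adsorption free
energy exists and equals `log μ`** — `Z⁺_n(a)^{1/n} → μ(ℤ²)`, by the squeeze `b_n ≤ Z⁺_n(a) ≤ c_n` and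
`b_n^{1/n} → μ`, `c_n^{1/n} → μ`. [cite: BeatonGuttmannJensen2012Adsorption, §1 (p. 2)]
[cite: MadrasSlade1993, Corollary 3.1.6, eq. (3.1.10) (p. 61)] -/
theorem tendsto_adsZ_rpow_of_le_one {a : ℝ} (ha0 : 0 ≤ a) (ha1 : a ≤ 1) :
    Tendsto (fun n : ℕ => (adsZ n a) ^ (1 / (n : ℝ))) atTop (𝓝 (connectiveConstant 2)) := by
  refine tendsto_of_tendsto_of_tendsto_of_le_of_le (tendsto_bridgeCount_rpow (d := 2)) (tendsto_count_rpow 2)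
    (fun n => ?_) (fun n => ?_)
  · exact Real.rpow_le_rpow (Nat.cast_nonneg _) (bridgeCount_le_adsZ n ha0) (by positivity)
  · exact Real.rpow_le_rpow (adsZ_nonneg n ha0) (adsZ_le_count n ha0 ha1) (by positivity)

/-- **No adsorption at `a ≤ 1` above the connective constant**: for `0 ≤ a ≤ 1` and `Λ > μ(ℤ²)`, `¬ AdsorbedAbove a Λ`
(`Z⁺_n(a) ≤ c_n = μ^{n + o(n)} ≪ Λⁿ`). With `adsorbedAbove_212` this brackets the transition: `1 < a_c`-side statements need
`Λ > μ`, which the tree's `μ ≤ 2.688 < 2.69` supplies. [cite: BeatonGuttmannJensen2012Adsorption, §1 (p. 2)] -/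
theorem not_adsorbedAbove_of_le_one {a Λ : ℝ} (ha0 : 0 ≤ a) (ha1 : a ≤ 1) (hΛ : connectiveConstant 2 < Λ) :
    ¬ AdsorbedAbove a Λ := by
  rintro ⟨K, hK, hKn⟩
  have hμ := connectiveConstant_pos 2
  set ν : ℝ := (connectiveConstant 2 + Λ) / 2 with hν
  have hμν : connectiveConstant 2 < ν := by rw [hν]; linarith
  have hνΛ : ν < Λ := by rw [hν]; linarith
  have hν0 : 0 < ν := lt_trans hμ hμν
  -- eventually `c_n^{1/n} < ν`, hence `c_n < νⁿ`
  have h1 : ∀ᶠ n : ℕ in atTop, (count 2 n : ℝ) < ν ^ n := by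
    have hev := (tendsto_count_rpow 2).eventually (gt_mem_nhds hμν)
    filter_upwards [hev, eventually_gt_atTop 0] with n hn hn0
    have hc : (0 : ℝ) ≤ count 2 n := Nat.cast_nonneg _
    have key : ((count 2 n : ℝ) ^ (1 / (n : ℝ))) ^ n = count 2 n := by
      rw [one_div, Real.rpow_inv_natCast_pow hc (Nat.pos_iff_ne_zero.1 hn0)]
    calc (count 2 n : ℝ) = ((count 2 n : ℝ) ^ (1 / (n : ℝ))) ^ n := key.symm
      _ < ν ^ n := pow_lt_pow_left₀ hn (Real.rpow_nonneg hc _) (Nat.pos_iff_ne_zero.1 hn0)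
  -- eventually `νⁿ < K Λⁿ`
  have h2 : ∀ᶠ n : ℕ in atTop, ν ^ n < K * Λ ^ n := by
    have hq : 1 < Λ / ν := (one_lt_div hν0).2 hνΛ
    have hev := (tendsto_pow_atTop_atTop_of_one_lt hq).eventually (eventually_gt_atTop (1 / K))
    filter_upwards [hev] with n hn
    have hνn : 0 < ν ^ n := pow_pos hν0 n
    rw [div_pow, lt_div_iff₀ hνn, one_div, inv_mul_lt_iff₀ hK] at hn
    linarith
  obtain ⟨n, hn1, hn2⟩ := (h1.and h2).exists
  have := hKn n
  have := adsZ_le_count n ha0 ha1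
  linarith

end Literature.Probability.RandomPlanarGeometry.SAW.Zd

/-! ### The printed lower bound `κ(α) ≥ max[log μ, α]` (finite forms) -/

namespace Literature.Probability.RandomPlanarGeometry.SAW.Zd

/-- The trajectory of the word along the wall (`n` east steps): `(0, i)` at time `i ≤ n`. [cite: BeatonGuttmannJensen2012Adsorption, §1 (p. 2)] -/
theorem traj_replicate_east {n i : ℕ} (hi : i ≤ n) : traj (List.replicate n (1 : Step)) i = ![0, (i : ℤ)] := by
  rw [traj, List.take_replicate, min_eq_left hi]
  induction i with
  | zero => simp; funext t; fin_cases t <;> rfl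
  | succ i ih =>
    rw [List.replicate_succ, wEnd_cons, ih (by omega)]
    funext t; fin_cases t
    · simp [Step.vec, Step.dx, Step.dy]
    · simp [Step.vec, Step.dx, Step.dy]; ring

/-- The walk along the wall is a half-plane walk with `n` wall visits. [cite: BeatonGuttmannJensen2012Adsorption, §1 (p. 2)] -/
theorem traj_replicate_east_mem_hpWalks (n : ℕ) : traj (List.replicate n (1 : Step)) ∈ hpWalks n := by
  classical
  have hsaw : IsSAW (List.replicate n (1 : Step)) := by
    rw [isSAW_iff_injOn]
    intro i hi j hj hij
    simp only [Set.mem_setOf_eq, List.length_replicate] at hi hj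
    rw [traj_replicate_east hi, traj_replicate_east hj] at hij
    have := congrFun hij 1
    simp at this
    exact this
  unfold hpWalks
  rw [Finset.mem_filter]
  refine ⟨traj_mem_saws (List.length_replicate) hsaw, fun i hi => ?_⟩
  rw [traj_replicate_east hi]
  simp

/-- The walk along the wall visits the wall at every time `1, …, n`. [cite: BeatonGuttmannJensen2012Adsorption, §1 (p. 2)] -/
theorem wallVisits_traj_replicate_east (n : ℕ) : wallVisits n (traj (List.replicate n (1 : Step))) = n := by
  classical
  unfold wallVisits
  have : ((range (n + 1)).filter fun k => 1 ≤ k ∧ traj (List.replicate n (1 : Step)) k 0 = 0) =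
      (range (n + 1)).filter fun k => 1 ≤ k := by
    refine Finset.filter_congr fun k hk => ?_
    rw [Finset.mem_range] at hk
    rw [traj_replicate_east (by omega)]
    simp
  have h2 : ((range (n + 1)).filter fun k => 1 ≤ k) = Icc 1 n := by
    ext k
    simp only [Finset.mem_filter, Finset.mem_range, Finset.mem_Icc]
    omega
  rw [this, h2, Nat.card_Icc]
  omega

/-- **`aⁿ ≤ Z⁺_n(a)`** (`a ≥ 0`): the walk along the wall alone — the finite form of `κ(α) ≥ α`.
[cite: BeatonGuttmannJensen2012Adsorption, §1 (p. 2)] -/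
theorem pow_le_adsZ (n : ℕ) {a : ℝ} (ha : 0 ≤ a) : a ^ n ≤ adsZ n a := by
  classical
  unfold adsZ
  have h := Finset.single_le_sum (f := fun ω => a ^ wallVisits n ω) (fun _ _ => pow_nonneg ha _)
    (traj_replicate_east_mem_hpWalks n)
  rwa [wallVisits_traj_replicate_east] at h

/-- `AdsorbedAbove a a` for every `a > 0` (`κ(α) ≥ α`). [cite: BeatonGuttmannJensen2012Adsorption, §1 (p. 2)] -/
theorem adsorbedAbove_self {a : ℝ} (ha : 0 < a) : AdsorbedAbove a a :=
  ⟨1, one_pos, fun n => by rw [one_mul]; exact pow_le_adsZ n ha.le⟩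

/-- A positive constant below `Z⁺_n(a) Λ^{-n}` for `n < N` (all `Z⁺_n(a) > 0`). [cite: BeatonGuttmannJensen2012Adsorption, §1 (p. 2)] -/
private theorem exists_const_le_adsZ (N : ℕ) {a Λ : ℝ} (hpos : ∀ n, 0 < adsZ n a) (hΛ : 0 < Λ) :
    ∃ K : ℝ, 0 < K ∧ ∀ n < N, K * Λ ^ n ≤ adsZ n a := by
  induction N with
  | zero => exact ⟨1, one_pos, fun n hn => absurd hn (Nat.not_lt_zero _)⟩
  | succ N ih =>
    obtain ⟨K, hK, hKle⟩ := ih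
    refine ⟨min K (adsZ N a / Λ ^ N), lt_min hK (div_pos (hpos N) (pow_pos hΛ _)), fun n hn => ?_⟩
    rcases Nat.lt_succ_iff_lt_or_eq.1 hn with hlt | rfl
    · exact le_trans (mul_le_mul_of_nonneg_right (min_le_left _ _) (pow_nonneg hΛ.le _)) (hKle n hlt)
    · calc min K (adsZ n a / Λ ^ n) * Λ ^ n ≤ adsZ n a / Λ ^ n * Λ ^ n :=
            mul_le_mul_of_nonneg_right (min_le_right _ _) (pow_nonneg hΛ.le _)
        _ = adsZ n a := div_mul_cancel₀ _ (pow_ne_zero _ hΛ.ne')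

/-- **`AdsorbedAbove a Λ` for every `a ≥ 0` and every `0 < Λ < μ(ℤ²)`** — the finite form of `κ(α) ≥ log μ` for all `α`
(`Z⁺_n(a) ≥ b_n ≥ e^{-c√n} μⁿ`, Hammersley–Welsh). [cite: BeatonGuttmannJensen2012Adsorption, §1 (p. 2)]
[cite: MadrasSlade1993, Corollary 3.1.6, eq. (3.1.9) (p. 61)] -/
theorem adsorbedAbove_of_lt_connectiveConstant {a Λ : ℝ} (ha : 0 ≤ a) (hΛ0 : 0 < Λ) (hΛ : Λ < connectiveConstant 2) :
    AdsorbedAbove a Λ := by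
  obtain ⟨c, hc⟩ := exp_mul_pow_le_bridgeCount (d := 2)
  have hμ := connectiveConstant_pos 2
  have hlow : ∀ n : ℕ, Real.exp (-(c * Real.sqrt n)) * connectiveConstant 2 ^ n ≤ adsZ n a :=
    fun n => (hc n).trans (bridgeCount_le_adsZ n ha)
  have hpos : ∀ n, 0 < adsZ n a := fun n => lt_of_lt_of_le (by positivity) (hlow n)
  -- `r = log(μ/Λ) > 0` and `μ = Λ e^r`
  set r : ℝ := Real.log (connectiveConstant 2 / Λ) with hr
  have hr0 : 0 < r := Real.log_pos ((one_lt_div hΛ0).2 hΛ)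
  have hμeq : connectiveConstant 2 = Λ * Real.exp r := by
    rw [hr, Real.exp_log (div_pos hμ hΛ0)]
    field_simp
  -- beyond `N₀ = ⌈(c/r)²⌉ + 1` the Hammersley–Welsh loss is absorbed: `Λⁿ ≤ e^{-c√n} μⁿ`
  set N₀ : ℕ := ⌈(c / r) ^ 2⌉₊ + 1 with hN₀
  have htail : ∀ n : ℕ, N₀ ≤ n → Λ ^ n ≤ Real.exp (-(c * Real.sqrt n)) * connectiveConstant 2 ^ n := by
    intro n hn
    have hn' : (c / r) ^ 2 ≤ n := by
      have h1 := Nat.le_ceil ((c / r) ^ 2)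
      have h2 : (⌈(c / r) ^ 2⌉₊ : ℝ) ≤ n := by exact_mod_cast (by omega : ⌈(c / r) ^ 2⌉₊ ≤ n)
      linarith
    have hsq : c / r ≤ Real.sqrt n := by
      rcases le_or_gt 0 (c / r) with h | h
      · calc c / r = Real.sqrt ((c / r) ^ 2) := (Real.sqrt_sq h).symm
          _ ≤ Real.sqrt n := Real.sqrt_le_sqrt hn'
      · exact le_trans h.le (Real.sqrt_nonneg _)
    have hcn : c * Real.sqrt n ≤ (n : ℝ) * r := by
      have h1 : c ≤ Real.sqrt n * r := (div_le_iff₀ hr0).1 hsq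
      calc c * Real.sqrt n ≤ Real.sqrt n * r * Real.sqrt n := mul_le_mul_of_nonneg_right h1 (Real.sqrt_nonneg _)
        _ = (n : ℝ) * r := by
          rw [mul_comm (Real.sqrt n) r, mul_assoc, Real.mul_self_sqrt (Nat.cast_nonneg _), mul_comm]
    have key : Real.exp (-(c * Real.sqrt n)) * connectiveConstant 2 ^ n =
        Λ ^ n * Real.exp ((n : ℝ) * r - c * Real.sqrt n) := by
      rw [hμeq, mul_pow, ← Real.exp_nat_mul, Real.exp_sub, Real.exp_neg]
      field_simp
    rw [key]
    calc Λ ^ n = Λ ^ n * Real.exp 0 := by rw [Real.exp_zero, mul_one]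
      _ ≤ Λ ^ n * Real.exp ((n : ℝ) * r - c * Real.sqrt n) :=
          mul_le_mul_of_nonneg_left (Real.exp_le_exp.2 (by linarith)) (pow_nonneg hΛ0.le _)
  obtain ⟨K, hK, hKle⟩ := exists_const_le_adsZ N₀ hpos hΛ0
  refine ⟨min K 1, lt_min hK one_pos, fun n => ?_⟩
  rcases lt_or_ge n N₀ with hn | hn
  · exact le_trans (mul_le_mul_of_nonneg_right (min_le_left _ _) (pow_nonneg hΛ0.le _)) (hKle n hn)
  · calc min K 1 * Λ ^ n ≤ 1 * Λ ^ n := mul_le_mul_of_nonneg_right (min_le_right _ _) (pow_nonneg hΛ0.le _)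
      _ = Λ ^ n := one_mul _
      _ ≤ Real.exp (-(c * Real.sqrt n)) * connectiveConstant 2 ^ n := htail n hn
      _ ≤ adsZ n a := hlow n


/-- **The desorbed window with explicit rates** (`0 ≤ a ≤ 1`, every `N`):
`e^{-(c₁+8)√N} μ^N ≤ b_N ≤ Z⁺_N(a) ≤ c_N ≤ (N+1) e^{6√(N+1)} μ^{N+1}` — the tree's explicit Hammersley–Welsh pair
(`exp_mul_pow_le_bridgeCount_explicit`, `count_le_mul_exp_mul_bridgeCount` with `bridgeCount_le_pow`; Madras–Slade
(3.1.7)/(3.1.9)) transported to the adsorption partition function. [cite: BeatonGuttmannJensen2012Adsorption, §1 (p. 2)]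
[cite: MadrasSlade1993, Theorem 3.1.1 and Corollary 3.1.6 (pp. 57–61)] -/
theorem adsZ_window_of_le_one {a : ℝ} (ha0 : 0 ≤ a) (ha1 : a ≤ 1) (N : ℕ) :
    Real.exp (-(((count 2 1 : ℝ) + 8) * Real.sqrt N)) * connectiveConstant 2 ^ N ≤ adsZ N a ∧
      adsZ N a ≤ (N + 1) * Real.exp (6 * Real.sqrt (N + 1)) * connectiveConstant 2 ^ (N + 1) := by
  refine ⟨(exp_mul_pow_le_bridgeCount_explicit N).trans (bridgeCount_le_adsZ N ha0),
    (adsZ_le_count N ha0 ha1).trans ((count_le_mul_exp_mul_bridgeCount N).trans ?_)⟩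
  exact mul_le_mul_of_nonneg_left (bridgeCount_le_pow (N + 1)) (by positivity)

end Literature.Probability.RandomPlanarGeometry.SAW.Zd
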